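import Mathlib
import Summits.ResolutionOfSingularities.ResolutionOfSingularities.Theorems.RadicialJungCleanModelsCleanPrincipalizationOfProp44
import Literature.AlgebraicGeometry.Resolution.PermissibleCentres
import HarnessLib

/-!
# Route `RadicialJung`, crux `CleanModels` (stmt-ResolutionOfSingularities-15917), line `Sketch` rev 18, stub 4e
# `stub_cleanPrincipalization3`: POINT CENTRES ARE FREE in clean-permissible sequences

API for the future prover of the research residue X44c / X_perm of 4e (memo `Cruxes/CleanModels/Lines/Sketch-memo-4e-cleanPermissible.md`):
extending a clean Cossart–Piltant sequence (`IsCleanRegularCentreBlowupSeq`, ✓ p683310) or a clean-permissible sequence for an idealistic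
exponent (`IsCleanPermissibleSeq`, ✓ p684619) by the blowing up of a CLOSED POINT costs nothing beyond what the non-clean constructors ask:
at a closed point the centre ideal is the maximal ideal (`stalkIdeal_vanishingIdeal_singleton`), where clean-regular IS clean-permissible
(✓ `cleanPermissible_of_cleanRegAt`), and clean-regularity at that point is available along the sequence (✓ `IsCleanRegularCentreBlowupSeq.cleanRegAt`).
So the two isolated-point slices and every point step of the tree's CP 2008 Prop. 4.4 assembly transfer verbatim to the clean setting; only
curve centres carry the research content.

* `IsCleanRegularCentreBlowupSeq.cons_point`, `IsCleanPermissibleSeq.cons_point`.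

Honest framing: OURS, plumbing; nothing here proves resolution in characteristic `p` or any case of `CleanModels`.
-/

noncomputable section

set_option linter.dupNamespace false -- mandated namespace of this single-conjunct summit

open IsLocalRing CategoryTheory AlgebraicGeometry TopologicalSpace
open Literature.AlgebraicGeometry.Resolution Literature.AlgebraicGeometry.Motives
open Scheme.IdealSheafData

namespace Summit.ResolutionOfSingularities.ResolutionOfSingularities.Theorems.RadicialJung.CleanModels

/-- **Closed-point centres are free (Cossart–Piltant sequences).**  A clean Cossart–Piltant sequence `σ : S' → S` for `J`, `G` extends by the
blowing up `τ` of a closed point `s ∈ S'` of the non-locally-principal locus of `J𝒪_{S'}` (reduced point subscheme integral and regular, as in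
`IsRegularCentreBlowupSeq.cons`) as soon as the line of `σ^♯ G` is clean-regular at `s` — which it is whenever the line of `G` is clean-regular
everywhere on `S` (`IsCleanRegularCentreBlowupSeq.cleanRegAt`). [cite: Piltant2013, §2 Axiom 2 (ii)] -/
theorem IsCleanRegularCentreBlowupSeq.cons_point {p : ℕ} (hp : p.Prime) {S'' S' S : Scheme.{0}} [IsIntegral S''] [IsIntegral S']
    [IsIntegral S] (τ : S'' ⟶ S') [IsDominant τ] (σ : S' ⟶ S) [IsDominant σ] (J : S.IdealSheafData) (G : S.functionField)
    [CharP S.functionField p] (h : IsCleanRegularCentreBlowupSeq p σ J G) (s : S') (hs : IsClosed ({s} : Set S'))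
    (hint : IsIntegral (vanishingIdeal ⟨{s}, hs⟩).subscheme) (hreg : Scheme.IsRegular (vanishingIdeal ⟨{s}, hs⟩).subscheme)
    (hnp : ¬ IsLocallyPrincipalAt (J.comap σ) s) (hτ : IsBlowup τ (vanishingIdeal ⟨{s}, hs⟩))
    (hclean : CleanRegAt p (algebraMap (S'.presheaf.stalk s) S'.functionField) (RatFn.functionFieldMap σ G)) :
    IsCleanRegularCentreBlowupSeq p (τ ≫ σ) J G := by
  haveI : Fact p.Prime := ⟨hp⟩
  haveI : CharP S'.functionField p := charP_of_injective_ringHom (RatFn.functionFieldMap σ).injective p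
  refine IsCleanRegularCentreBlowupSeq.cons τ σ J G ⟨{s}, hs⟩ h hint hreg (fun y hy => ?_) hτ (fun y hy => ?_)
  · have hy' : y = s := hy
    subst hy'
    exact hnp
  · have hy' : y = s := hy
    subst hy'
    haveI : IsLocalRing (S'.presheaf.stalk y) := inferInstance
    rw [stalkIdeal_vanishingIdeal_singleton hs]
    exact cleanPermissible_of_cleanRegAt p _ hclean

/-- **Closed-point centres are free (idealistic exponents).**  A clean-permissible sequence `π : X' → X` for `(J, μ)`, `G` with weak transform `J'`
extends by the blowing up `τ` of a closed point `x ∈ X'` with `ord_x J' = μ` (reduced point subscheme integral and regular, `X''` integral, `τ`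
dominant) as soon as the line of `π^♯ G` is clean-regular at `x`. [cite: CossartPiltant2008, proof of Prop. 4.2] [cite: Piltant2013, §2 Axiom 2 (ii)] -/
theorem IsCleanPermissibleSeq.cons_point {p : ℕ} (hp : p.Prime) {X'' X' X : Scheme.{0}} [IsIntegral X''] [IsIntegral X'] [IsIntegral X]
    (τ : X'' ⟶ X') [IsDominant τ] (π : X' ⟶ X) [IsDominant π] (J : X.IdealSheafData) (μ : ℕ) (J' : X'.IdealSheafData)
    (G : X.functionField) [CharP X.functionField p] (h : IsCleanPermissibleSeq p π J μ J' G) (x : X')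
    (hx : IsClosed ({x} : Set X')) (hint : IsIntegral (vanishingIdeal ⟨{x}, hx⟩).subscheme)
    (hreg : Scheme.IsRegular (vanishingIdeal ⟨{x}, hx⟩).subscheme) (hord : idealOrder J' x = μ)
    (hτ : IsBlowup τ (vanishingIdeal ⟨{x}, hx⟩))
    (hclean : CleanRegAt p (algebraMap (X'.presheaf.stalk x) X'.functionField) (RatFn.functionFieldMap π G)) :
    IsCleanPermissibleSeq p (τ ≫ π) J μ (controlledTransform τ (vanishingIdeal ⟨{x}, hx⟩) J' μ) G := by
  haveI : Fact p.Prime := ⟨hp⟩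
  haveI : CharP X'.functionField p := charP_of_injective_ringHom (RatFn.functionFieldMap π).injective p
  refine IsCleanPermissibleSeq.cons τ π J μ J' G ⟨{x}, hx⟩ h hint hreg (fun y hy => ?_) hτ (fun y hy => ?_)
  · have hy' : y = x := hy
    subst hy'
    exact hord
  · have hy' : y = x := hy
    subst hy'
    rw [stalkIdeal_vanishingIdeal_singleton hx]
    exact cleanPermissible_of_cleanRegAt p _ hclean

end Summit.ResolutionOfSingularities.ResolutionOfSingularities.Theorems.RadicialJung.CleanModels

end
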